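import Summits.KontsevichZagierPeriods.KontsevichZagierPeriods.Theorems.IsogenyCertificatesXMapKernelCellsUnconditional

/-!
# Verdict certificate — crux stmt-KontsevichZagierPeriods-10663 (`IsogenyCertificates.XMapKernel`), lead c3 (2026-08-17)

Every `example` below is closed by a theorem ALREADY IN THE TREE (no new mathematics): the crux is the
Kontsevich–Zagier period conjecture (summit statement / kernel form) unconditionally, and so is the single
open stub of each of the three registered lines. `#print axioms` of the tree theorems: propext,
Classical.choice, Quot.sound.
-/

open Summit.KontsevichZagierPeriods.KontsevichZagierPeriods.Theses.IsogenyCertificates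
open Summit.KontsevichZagierPeriods.IsogenyCertificates

/-- crux ↔ summit (p116992). -/
example : XMapKernel ↔ KontsevichZagierPeriods :=
  XMapKernelIffSummit.xMapKernel_iff_summit

/-- crux ↔ the named open conjecture `KZKernelConjecture` (p116992). -/
example : XMapKernel ↔ Literature.NumberTheory.Transcendental.KZKernelConjecture :=
  XMapKernelIffSummit.xMapKernel_iff_kzKernelConjecture

/-- line isogeny-orbit-collapse: its only open stub `stub_reductionToRealPeriodSector` ↔ summit (p119755). -/
example := XMapKernelCells.reductionToRealPeriodSector_iff_summit_holds

/-- line derived-datum-quasi-periods: its only open stub `stub_offCellReduction` ↔ summit (p119755). -/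
example := XMapKernelCells.offCellReduction_iff_summit_holds

/-- line axiom-saturated-sector-peeling: its only open stub `stub_kernelModElliptic` ↔ summit (p119755). -/
example := XMapKernelCells.kernelModElliptic_iff_summit_holds

#print axioms Summit.KontsevichZagierPeriods.IsogenyCertificates.XMapKernelIffSummit.xMapKernel_iff_summit
#print axioms Summit.KontsevichZagierPeriods.IsogenyCertificates.XMapKernelIffSummit.xMapKernel_iff_kzKernelConjecture
#print axioms Summit.KontsevichZagierPeriods.IsogenyCertificates.XMapKernelCells.reductionToRealPeriodSector_iff_summit_holds
#print axioms Summit.KontsevichZagierPeriods.IsogenyCertificates.XMapKernelCells.offCellReduction_iff_summit_holds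
#print axioms Summit.KontsevichZagierPeriods.IsogenyCertificates.XMapKernelCells.kernelModElliptic_iff_summit_holds
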